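import Mathlib
import Summits.NavierStokesRegularity.FluidComputer.TransportSobolevCommutator
import HarnessLib

/-!
# The transport term on the lattice Sobolev scale, V: smooth multipliers and stretching at every order (instab g19, cell `ns-blowup`, 2026-08-27)

HONEST FRAMING (human ruling D-0035): nothing here is a claim about Navier–Stokes blow-up.
WHAT THIS IS NOT: not NS evidence — lattice (`ℤ^d`, Fourier-side) inequalities between `ℝ≥0∞`
sums, Mathlib + the tree's `Lattice*` toolkit only. No flow, operator, set `W` or certificate is
constructed.

PURPOSE (see part IV, `TransportSobolevCommutator`): the `H^σ` energy estimate that turns the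
bootstrap's level-uniform `H²` bound into RESIDENCE of the Galerkin levels in a polynomial box needs,
besides the rough × rough commutator of part IV, two bounds in which ONE factor is the smooth host:

* §3 `eNormSq_wmul_natCast_conv_sub_le_symb` — the SMOOTH-MULTIPLIER commutator estimate
  `‖Λ^σ(a ⋆ g) − a ⋆ (Λ^σ g)‖₀² ≤ (σ 2^σ)² A_σ(a)² ‖g‖²_{σ−1}` (all weight on the symbol; the
  positive-order twin of the tree's `Lattice.eNorm_wmul_conv_sub_le`, Warner 6.18 (17)) — used for
  advection BY the host, `(U·∇)û`;
* §4 `eNormSq_le_of_transport_domination` — Young + Peetre at any order `s ≥ 0` with the `ℓ¹`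
  weight on the ADVECTED factor: `‖f k‖ ≤ C ∑_l ‖c(k−l)‖ ⟨l⟩ ‖x l‖ ⇒ ‖f‖_s² ≤ 2^s C² A_{s+1}(x)² ‖c‖_s²`
  (part I's `TransportCommutatorLattice.eNormSq_two_le_of_transport_domination` is `s = 2`) — used
  for the stretching term `(û·∇)U`.

References: F. W. Warner, GTM 94 (1983), 6.18 (17); J. Peetre (1966) [folklore].
-/

noncomputable section

open scoped ENNReal NNReal ComplexConjugate

namespace Summit.NavierStokesRegularity.FluidComputer.TransportSobolevMultiplier

open Finset
open Literature.Analysis.FunctionSpaces Literature.Analysis.FunctionSpaces.Lattice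
open Literature.Analysis.FunctionSpaces.Torus
open Summit.NavierStokesRegularity.FluidComputer.TransportCommutatorLattice
open Summit.NavierStokesRegularity.FluidComputer.TransportSobolevCommutator

variable {d : Type*} [Fintype d]

/-! ## §3 The smooth-multiplier commutator estimate of natural order -/

section CommutatorSymb

variable {V W : Type*} [NormedAddCommGroup V] [NormedSpace ℂ V] [NormedAddCommGroup W]
  [NormedSpace ℂ W]

/-- **The commutator `[Λ^σ, a ⋆]` is an operator of order `σ − 1`, smooth-multiplier form**
(squared): for `σ ∈ ℕ`, a rapidly decreasing symbol `a` and a tempered family `g`,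

  `‖Λ^σ(a ⋆ g) − a ⋆ (Λ^σ g)‖₀² ≤ (σ 2^σ)² A_σ(a)² ‖g‖²_{σ−1}`,  `A_σ(a) = ∑_p ⟨p⟩^σ ‖a p‖`.

The positive-order twin of the tree's `Lattice.eNorm_wmul_conv_sub_le` (Warner 6.18 (17), order
`−σ`): kernel bound `abs_sobolevWeight_natCast_sub_le'` (all weight on the symbol) and Young's
inequality with the `ℓ¹` norm on the symbol. -/
theorem eNormSq_wmul_natCast_conv_sub_le_symb [CompleteSpace W] {a : (d → ℤ) → (V →L[ℂ] W)}
    (ha : RapidDecay a) {g : (d → ℤ) → V} (hg : Tempered g) {σ : ℕ} (hσ : 1 ≤ σ) :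
    eNormSq 0 (wmul (σ : ℝ) (conv a g) - conv a (wmul (σ : ℝ) g)) ≤
      ENNReal.ofReal ((σ * (2 : ℝ) ^ σ) ^ 2) * symbNorm (σ : ℝ) a ^ 2 * eNormSq ((σ : ℝ) - 1) g := by
  set C : ℝ := σ * (2 : ℝ) ^ σ with hC
  have hC0 : 0 ≤ C := by positivity
  have hcast : (((σ - 1 : ℕ) : ℝ)) = (σ : ℝ) - 1 := by rw [Nat.cast_sub hσ, Nat.cast_one]
  obtain ⟨α, hα⟩ : ∃ α : (d → ℤ) → ℝ≥0∞, ∀ p, α p = ENNReal.ofReal (sobolevWeight (σ : ℝ) p * ‖a p‖) :=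
    ⟨_, fun _ => rfl⟩
  obtain ⟨β, hβ⟩ : ∃ β : (d → ℤ) → ℝ≥0∞, ∀ l,
      β l = ENNReal.ofReal (sobolevWeight ((σ : ℝ) - 1) l * ‖g l‖) := ⟨_, fun _ => rfl⟩
  have hterm : ∀ k, ‖(wmul (σ : ℝ) (conv a g) - conv a (wmul (σ : ℝ) g)) k‖ₑ ≤
      ENNReal.ofReal C * ∑' l, α (k - l) * β l := by
    intro k
    rw [wmul_conv_sub_conv_wmul_apply ha hg, ← ENNReal.tsum_mul_left]
    refine enorm_tsum_le_tsum_enorm.trans (ENNReal.tsum_le_tsum fun l => ?_)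
    rw [enorm_smul, ← ofReal_norm, ← ofReal_norm (a (k - l) (g l)), Complex.norm_real,
      Real.norm_eq_abs]
    have hb := abs_sobolevWeight_natCast_sub_le' σ k l
    have hbσ : sobolevWeight 1 l ^ (σ - 1) = sobolevWeight ((σ : ℝ) - 1) l := by
      rw [← hcast, sobolevWeight_natCast]
    rw [hbσ] at hb
    have hag : ‖a (k - l) (g l)‖ ≤ ‖a (k - l)‖ * ‖g l‖ := (a (k - l)).le_opNorm _
    have hpos1 := sobolevWeight_pos (σ : ℝ) (k - l)
    have hpos3 := sobolevWeight_pos ((σ : ℝ) - 1) l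
    have hx : 0 ≤ sobolevWeight (σ : ℝ) (k - l) * ‖a (k - l)‖ := mul_nonneg hpos1.le (norm_nonneg _)
    have hreal : |sobolevWeight (σ : ℝ) k - sobolevWeight (σ : ℝ) l| * ‖a (k - l) (g l)‖ ≤
        C * ((sobolevWeight (σ : ℝ) (k - l) * ‖a (k - l)‖) *
          (sobolevWeight ((σ : ℝ) - 1) l * ‖g l‖)) := by
      calc |sobolevWeight (σ : ℝ) k - sobolevWeight (σ : ℝ) l| * ‖a (k - l) (g l)‖
          ≤ (C * sobolevWeight (σ : ℝ) (k - l) * sobolevWeight ((σ : ℝ) - 1) l) *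
              (‖a (k - l)‖ * ‖g l‖) := mul_le_mul hb hag (norm_nonneg _) (by positivity)
        _ = _ := by ring
    calc ENNReal.ofReal |sobolevWeight (σ : ℝ) k - sobolevWeight (σ : ℝ) l| *
          ENNReal.ofReal ‖a (k - l) (g l)‖
        = ENNReal.ofReal (|sobolevWeight (σ : ℝ) k - sobolevWeight (σ : ℝ) l| * ‖a (k - l) (g l)‖) :=
          (ENNReal.ofReal_mul (abs_nonneg _)).symm
      _ ≤ ENNReal.ofReal (C * ((sobolevWeight (σ : ℝ) (k - l) * ‖a (k - l)‖) *
          (sobolevWeight ((σ : ℝ) - 1) l * ‖g l‖))) := ENNReal.ofReal_le_ofReal hreal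
      _ = ENNReal.ofReal C * (α (k - l) * β l) := by
          rw [ENNReal.ofReal_mul hC0, hα, hβ, ENNReal.ofReal_mul hx]
  have hαsum : ∑' p, α p = symbNorm (σ : ℝ) a := tsum_congr fun p => by
    rw [hα, ENNReal.ofReal_mul (sobolevWeight_pos _ _).le, ofReal_norm]
  have hβsum : ∑' l, β l ^ 2 = eNormSq ((σ : ℝ) - 1) g := tsum_congr fun l => by
    rw [hβ, ← ENNReal.ofReal_pow (by positivity [sobolevWeight_pos ((σ : ℝ) - 1) l]), mul_pow,
      ENNReal.ofReal_mul (sq_nonneg _), ← ofReal_norm, ENNReal.ofReal_pow (norm_nonneg _)]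
  calc eNormSq 0 (wmul (σ : ℝ) (conv a g) - conv a (wmul (σ : ℝ) g))
      = ∑' k, ‖(wmul (σ : ℝ) (conv a g) - conv a (wmul (σ : ℝ) g)) k‖ₑ ^ 2 := by simp [eNormSq]
    _ ≤ ∑' k, (ENNReal.ofReal C * ∑' l, α (k - l) * β l) ^ 2 :=
        ENNReal.tsum_le_tsum fun k => by gcongr; exact hterm k
    _ = ENNReal.ofReal C ^ 2 * ∑' k, (∑' l, α (k - l) * β l) ^ 2 := by
        simp only [mul_pow]; exact ENNReal.tsum_mul_left
    _ ≤ ENNReal.ofReal C ^ 2 * ((∑' p, α p) ^ 2 * ∑' l, β l ^ 2) := by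
        gcongr; exact young_sq α β
    _ = ENNReal.ofReal (C ^ 2) * symbNorm (σ : ℝ) a ^ 2 * eNormSq ((σ : ℝ) - 1) g := by
        rw [hαsum, hβsum, ENNReal.ofReal_pow hC0, mul_assoc]

end CommutatorSymb

/-! ## §4 Young + Peetre at any order, `ℓ¹` weight on the advected factor -/

section Domination

variable {E' F' G' : Type*} [NormedAddCommGroup E'] [NormedAddCommGroup F'] [NormedAddCommGroup G']

/-- **Young + Peetre with the `ℓ¹` weight on the ADVECTED factor, order `s ≥ 0`**: if a family `f`
is dominated by the transport-type convolution `‖f k‖ ≤ C ∑_l ‖c(k−l)‖ ⟨l⟩ ‖x l‖` (one derivative on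
`x`), then `‖f‖_s² ≤ 2^s C² A_{s+1}(x)² ‖c‖_s²` with `A_{s+1}(x) = ∑_l ⟨l⟩^{s+1} ‖x l‖` — Peetre
`⟨k⟩^s ≤ 2^{s/2}⟨k−l⟩^s⟨l⟩^s` (`Torus.sobolevWeight_le_peetre_of_nonneg`) puts `⟨k−l⟩^s` on the `ℓ²`
factor `c` and `⟨l⟩^s·⟨l⟩ = ⟨l⟩^{s+1}` on the `ℓ¹` factor `x`, then `young_sq'`. Part I's
`TransportCommutatorLattice.eNormSq_two_le_of_transport_domination` is the case `s = 2`; with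
`TransportCommutatorLattice.enorm_transport_apply_le` it bounds the stretching term `(û·∇)U` at
order `s` by `‖û‖_s A_{s+1}(U)`. -/
theorem eNormSq_le_of_transport_domination {s : ℝ} (hs : 0 ≤ s) (c : (d → ℤ) → E')
    (x : (d → ℤ) → F') {f : (d → ℤ) → G'} (C : ℝ≥0∞)
    (hdom : ∀ k, ‖f k‖ₑ ≤ C * ∑' l, ‖c (k - l)‖ₑ * (ENNReal.ofReal (sobolevWeight 1 l) * ‖x l‖ₑ)) :
    eNormSq s f ≤ ENNReal.ofReal ((2 : ℝ) ^ s) * C ^ 2 *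
      (∑' l, ENNReal.ofReal (sobolevWeight (s + 1) l) * ‖x l‖ₑ) ^ 2 * eNormSq s c := by
  obtain ⟨α, hα⟩ : ∃ α : (d → ℤ) → ℝ≥0∞, ∀ l,
      α l = ENNReal.ofReal (sobolevWeight (s + 1) l) * ‖x l‖ₑ := ⟨_, fun _ => rfl⟩
  obtain ⟨β, hβ⟩ : ∃ β : (d → ℤ) → ℝ≥0∞, ∀ l,
      β l = ENNReal.ofReal (sobolevWeight s l) * ‖c l‖ₑ := ⟨_, fun _ => rfl⟩
  set D : ℝ := (2 : ℝ) ^ (s / 2) with hD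
  have hD0 : 0 ≤ D := by positivity
  have hDsq : D ^ 2 = (2 : ℝ) ^ s := by
    rw [hD, ← Real.rpow_natCast, ← Real.rpow_mul (by norm_num)]; norm_num
  have hpeetre : ∀ k l : d → ℤ, sobolevWeight s k ≤ D * sobolevWeight s (k - l) * sobolevWeight s l :=
    fun k l => sobolevWeight_le_peetre_of_nonneg hs k l
  have hs1 : ∀ l : d → ℤ, sobolevWeight s l * sobolevWeight 1 l = sobolevWeight (s + 1) l :=
    fun l => by rw [← sobolevWeight_add]
  -- termwise bound
  have hterm : ∀ k, ENNReal.ofReal (sobolevWeight s k) * ‖f k‖ₑ ≤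
      ENNReal.ofReal D * C * ∑' l, β (k - l) * α l := by
    intro k
    calc ENNReal.ofReal (sobolevWeight s k) * ‖f k‖ₑ
        ≤ ENNReal.ofReal (sobolevWeight s k) *
            (C * ∑' l, ‖c (k - l)‖ₑ * (ENNReal.ofReal (sobolevWeight 1 l) * ‖x l‖ₑ)) := by
          gcongr; exact hdom k
      _ = C * ∑' l, ENNReal.ofReal (sobolevWeight s k) *
            (‖c (k - l)‖ₑ * (ENNReal.ofReal (sobolevWeight 1 l) * ‖x l‖ₑ)) := by
          rw [ENNReal.tsum_mul_left]; ring
      _ ≤ C * ∑' l, ENNReal.ofReal (D * sobolevWeight s (k - l) * sobolevWeight s l) *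
            (‖c (k - l)‖ₑ * (ENNReal.ofReal (sobolevWeight 1 l) * ‖x l‖ₑ)) := by
          gcongr with l; exact hpeetre k l
      _ = C * ∑' l, ENNReal.ofReal D * (β (k - l) * α l) := by
          congr 1
          refine tsum_congr fun l => ?_
          rw [hβ, hα, ← hs1 l, ENNReal.ofReal_mul (by positivity [sobolevWeight_pos s (k - l)]),
            ENNReal.ofReal_mul hD0, ENNReal.ofReal_mul (sobolevWeight_pos s l).le]
          ring
      _ = ENNReal.ofReal D * C * ∑' l, β (k - l) * α l := by rw [ENNReal.tsum_mul_left]; ring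
  -- square and sum
  have hα' : ∑' l, ENNReal.ofReal (sobolevWeight (s + 1) l) * ‖x l‖ₑ = ∑' l, α l :=
    tsum_congr fun l => (hα l).symm
  have hβ2 : ∑' l, β l ^ 2 = eNormSq s c := tsum_congr fun l => by
    rw [hβ, mul_pow, ENNReal.ofReal_pow (sobolevWeight_pos _ _).le]
  rw [hα']
  calc eNormSq s f = ∑' k, (ENNReal.ofReal (sobolevWeight s k) * ‖f k‖ₑ) ^ 2 :=
        tsum_congr fun k => by rw [mul_pow, ENNReal.ofReal_pow (sobolevWeight_pos _ _).le]
    _ ≤ ∑' k, (ENNReal.ofReal D * C * ∑' l, β (k - l) * α l) ^ 2 :=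
        ENNReal.tsum_le_tsum fun k => by gcongr ?_ ^ 2; exact hterm k
    _ = (ENNReal.ofReal D * C) ^ 2 * ∑' k, (∑' l, β (k - l) * α l) ^ 2 := by
        rw [← ENNReal.tsum_mul_left]
        exact tsum_congr fun k => by rw [mul_pow]
    _ ≤ (ENNReal.ofReal D * C) ^ 2 * ((∑' l, β l ^ 2) * (∑' l, α l) ^ 2) := by
        gcongr; exact young_sq' β α
    _ = ENNReal.ofReal ((2 : ℝ) ^ s) * C ^ 2 * (∑' l, α l) ^ 2 * eNormSq s c := by
        rw [hβ2, ← hDsq, ENNReal.ofReal_pow hD0]; ring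

end Domination



end Summit.NavierStokesRegularity.FluidComputer.TransportSobolevMultiplier

end
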